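import Summits.CriticalPhenomena.PercolationContinuityZ3.Theorems.Transplant.FKConnectivityAllQTwoSumLaws
import HarnessLib

/-!
# Connectivity correlation inequalities for `φ_{w,q}`, every `q > 0` — TWO-SUMS, file 2: the MIXED case of Wagner's two-sum
# theorem (one edge in each part)

Support file (`--supports stmt-CriticalPhenomena-4575`), FK sub-lane `prim-bschramm-fk-1` (gen 6) of the post-continuity
programme; builds on p205010 (kernel theorem, internal audit signed; external expert review pending).  No definitions, no named
facts, no sorries; standard axioms.

Setting: two edge sets `E₁, E₂ ⊆ Sym2 V`, disjoint, living on vertex sets `V₁, V₂` with `V₁ ∩ V₂ ⊆ {s, t}`, `s ≠ t` (the two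
parts of a two-sum / parallel connection along the virtual edge `st`), network masses `NMᵢ = FK.netMass w q Eᵢ` under one ambient
weight vector `w` and `0 < q ≤ 1`; `C = {s ↔ t}`, `J_g = {g open}`.
* `FK.twoSum_mixed_alg` — the algebra: Wagner's "amazing" cancellation of the 32 terms (proof of Thm. 5.8(d), first case):
  with the bilinear two-sum law `X·NM(M₁ ∩ M₂) = q·a c + a d + b c + b d` (`(a,b)` = the `C / Cᶜ` masses of part 1 with mark `M₁`,
  `(c,d)` those of part 2 with mark `M₂`), the negative-correlation defect of `e ∈ E₁`, `f ∈ E₂` factorises as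
  `X²·(NM(J_e)NM(J_f) − NM(J_e ∩ J_f)NM(⊤)) = (1 − q)·Δ₁(e)·Δ₂(f)`, `Δᵢ(g) = NMᵢ(C∩J_g)NMᵢ(Cᶜ∩J_gᶜ) − NMᵢ(Cᶜ∩J_g)NMᵢ(C∩J_gᶜ)`
  ("`ΔN{e,f} = ΔL{e,g}·ΔM{g,f}/(1−q)`"), so it is `≥ 0` when `q ≤ 1` and both parts satisfy fk-2's single-edge monotonicity
  (MONO) `Δᵢ ≥ 0` (= EC⁺ for the terminals, `…AllQSPMono.lean`).
* **`FK.negCorr_net_twoSum_mixed`** — for `e ∉ E₂`, `f ∉ E₁`: (MONO) of part 1 at `e` and of part 2 at `f` give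
  `NM_{E₁∪E₂}(J_e ∩ J_f)·NM_{E₁∪E₂}(⊤) ≤ NM_{E₁∪E₂}(J_e)·NM_{E₁∪E₂}(J_f)`.
* **`FK.negCorr_twoSum_mixed`** — the same for the random-cluster measure: if `w` is supported in `E₁ ∪ E₂`, then
  `φ_{w,q}(J_e ∩ J_f) ≤ φ_{w,q}(J_e)·φ_{w,q}(J_f)`.
The (MONO) hypotheses are supplied by fk-2's `spMono_of_isTTSP` (two-terminal series–parallel parts, every `q > 0`) or, for parts
that are negatively associated for all weights, by `…TwoSumMono.lean` (next file).
[cite: Wagner2006, Prop. 5.6, Cor. 5.7, Thm. 5.8(d) (pp. 13–15)] [cite: Grimmett2006, §3.9 eq. (3.94) (pp. 63–64); §3.8 Thm. (3.91) (p. 62)]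
-/

noncomputable section

namespace Summit.CriticalPhenomena.PercolationContinuityZ3.Theorems

namespace FK

open MeasureTheory SimpleGraph Literature.Probability.LatticeModels Literature.Probability.Percolation
open Literature.Probability.Percolation.DecisionTree (ind ind_of_mem ind_of_not_mem ind_nonneg)
open scoped Classical

variable {V : Type*} [Fintype V]

/-! ### The algebra of the mixed case -/

omit [Fintype V] in
/-- **Wagner's cancellation (mixed case of Thm. 5.8(d))**: if the four composite masses are given by the bilinear two-sum law
from the marked masses `(a₁,b₁ | a₀,b₀)` of part 1 (mark `J_e` / `J_eᶜ`) and `(c₁,d₁ | c₀,d₀)` of part 2 (mark `J_f` / `J_fᶜ`),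
`X > 0`, `q ≤ 1`, and both parts satisfy (MONO) (`a₀b₁ ≤ a₁b₀`, `c₀d₁ ≤ c₁d₀`), then `N_{ef}·N ≤ N_e·N_f`; indeed
`X²(N_eN_f − N_{ef}N) = (1−q)(a₁b₀ − a₀b₁)(c₁d₀ − c₀d₁)`. [cite: Wagner2006, Thm. 5.8(d), proof, first case (p. 14)] -/
theorem twoSum_mixed_alg {X q a₁ a₀ b₁ b₀ c₁ c₀ d₁ d₀ Nef Ne Nf N : ℝ} (hX : 0 < X) (hq : q ≤ 1)
    (eEF : X * Nef = q * (a₁ * c₁) + a₁ * d₁ + b₁ * c₁ + b₁ * d₁)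
    (eE : X * Ne = q * (a₁ * (c₁ + c₀)) + a₁ * (d₁ + d₀) + b₁ * (c₁ + c₀) + b₁ * (d₁ + d₀))
    (eF : X * Nf = q * ((a₁ + a₀) * c₁) + (a₁ + a₀) * d₁ + (b₁ + b₀) * c₁ + (b₁ + b₀) * d₁)
    (eN : X * N = q * ((a₁ + a₀) * (c₁ + c₀)) + (a₁ + a₀) * (d₁ + d₀) + (b₁ + b₀) * (c₁ + c₀) + (b₁ + b₀) * (d₁ + d₀))
    (h₁ : a₀ * b₁ ≤ a₁ * b₀) (h₂ : c₀ * d₁ ≤ c₁ * d₀) : Nef * N ≤ Ne * Nf := by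
  have key : (X * Ne) * (X * Nf) - (X * Nef) * (X * N) = (1 - q) * ((a₁ * b₀ - a₀ * b₁) * (c₁ * d₀ - c₀ * d₁)) := by
    rw [eEF, eE, eF, eN]; ring
  have hnn : 0 ≤ (1 - q) * ((a₁ * b₀ - a₀ * b₁) * (c₁ * d₀ - c₀ * d₁)) :=
    mul_nonneg (by linarith) (mul_nonneg (by linarith) (by linarith))
  have h2 : (X * Nef) * (X * N) ≤ (X * Ne) * (X * Nf) := by linarith [key, hnn]
  have hX2 : 0 < X * X := mul_pos hX hX
  nlinarith [h2]

/-! ### The mixed case in network-mass form -/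

section Mixed

variable (w : Sym2 V → unitInterval) {q : ℝ} {E₁ E₂ : Set (Sym2 V)} {V₁ V₂ : Set V}

/-- **Two-sum, mixed case, network masses**: parts `E₁, E₂` glued along `{s, t}`, `0 < q ≤ 1`, `e` off the second part and `f`
off the first; if part 1 satisfies (MONO) at `e` and part 2 satisfies (MONO) at `f` (fk-2's `spMono` shape: for the terminals
`s, t`, closing the marked pair does not raise the connected fraction), then `e` and `f` are negatively correlated in the
composite: `NM(J_e ∩ J_f)·NM(⊤) ≤ NM(J_e)·NM(J_f)`. [cite: Wagner2006, Thm. 5.8(d), proof, first case (p. 14)]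
[cite: Grimmett2006, §3.9 eq. (3.94) (p. 63)] -/
theorem negCorr_net_twoSum_mixed (hq0 : 0 < q) (hq1 : q ≤ 1) (hd : Disjoint E₁ E₂) (h₁ : ∀ e ∈ E₁, ∀ z ∈ e, z ∈ V₁)
    (h₂ : ∀ e ∈ E₂, ∀ z ∈ e, z ∈ V₂) {s t : V} (hS : V₁ ∩ V₂ ⊆ {s, t}) (hst : s ≠ t) {e f : Sym2 V} (he : e ∉ E₂)
    (hf : f ∉ E₁)
    (mono₁ : netMass w q E₁ (openConn s t ∩ {η | e ∈ η}ᶜ) * netMass w q E₁ ((openConn s t)ᶜ ∩ {η | e ∈ η}) ≤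
      netMass w q E₁ (openConn s t ∩ {η | e ∈ η}) * netMass w q E₁ ((openConn s t)ᶜ ∩ {η | e ∈ η}ᶜ))
    (mono₂ : netMass w q E₂ (openConn s t ∩ {η | f ∈ η}ᶜ) * netMass w q E₂ ((openConn s t)ᶜ ∩ {η | f ∈ η}) ≤
      netMass w q E₂ (openConn s t ∩ {η | f ∈ η}) * netMass w q E₂ ((openConn s t)ᶜ ∩ {η | f ∈ η}ᶜ)) :
    netMass w q (E₁ ∪ E₂) ({η | e ∈ η} ∩ {η | f ∈ η}) * netMass w q (E₁ ∪ E₂) Set.univ ≤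
      netMass w q (E₁ ∪ E₂) {η | e ∈ η} * netMass w q (E₁ ∪ E₂) {η | f ∈ η} := by
  -- the four bilinear laws
  have lEF := netMass_parallel_two w q hd h₁ h₂ hS hst (markLocal_openPair he) (markLocal_openPair₂ hf)
  have lE := netMass_parallel_two w q hd h₁ h₂ hS hst (markLocal_openPair he) (markLocal_univ₂ E₁ E₂)
  have lF := netMass_parallel_two w q hd h₁ h₂ hS hst (markLocal_univ E₁ E₂) (markLocal_openPair₂ hf)
  have lN := netMass_parallel_two w q hd h₁ h₂ hS hst (markLocal_univ E₁ E₂) (markLocal_univ₂ E₁ E₂)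
  rw [Set.inter_univ] at lE
  rw [Set.univ_inter] at lF
  rw [Set.univ_inter] at lN
  simp only [Set.inter_univ] at lE lF lN
  -- the unmarked part masses split along the marks
  have sa : netMass w q E₁ (openConn s t) = netMass w q E₁ (openConn s t ∩ {η | e ∈ η}) +
      netMass w q E₁ (openConn s t ∩ {η | e ∈ η}ᶜ) := netMass_split w q E₁ _ _
  have sb : netMass w q E₁ (openConn s t)ᶜ = netMass w q E₁ ((openConn s t)ᶜ ∩ {η | e ∈ η}) +
      netMass w q E₁ ((openConn s t)ᶜ ∩ {η | e ∈ η}ᶜ) := netMass_split w q E₁ _ _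
  have sc : netMass w q E₂ (openConn s t) = netMass w q E₂ (openConn s t ∩ {η | f ∈ η}) +
      netMass w q E₂ (openConn s t ∩ {η | f ∈ η}ᶜ) := netMass_split w q E₂ _ _
  have sd : netMass w q E₂ (openConn s t)ᶜ = netMass w q E₂ ((openConn s t)ᶜ ∩ {η | f ∈ η}) +
      netMass w q E₂ ((openConn s t)ᶜ ∩ {η | f ∈ η}ᶜ) := netMass_split w q E₂ _ _
  rw [sa, sb, sc, sd] at lN
  rw [sc, sd] at lE
  rw [sa, sb] at lF
  exact twoSum_mixed_alg (pow_pos hq0 (Fintype.card V)) hq1 lEF lE lF lN mono₁ mono₂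

/-- **Two-sum, mixed case, for the random-cluster measure**: parts `E₁, E₂` glued along `{s, t}`, `0 < q ≤ 1`, `w` supported in
`E₁ ∪ E₂`, `e` off the second part, `f` off the first, (MONO) for part 1 at `e` and for part 2 at `f` ⟹
`φ_{w,q}(J_e ∩ J_f) ≤ φ_{w,q}(J_e)·φ_{w,q}(J_f)`. [cite: Wagner2006, Thm. 5.8(d), proof, first case (p. 14)]
[cite: Grimmett2006, §3.9 eq. (3.94) (p. 63)] -/
theorem negCorr_twoSum_mixed (hq0 : 0 < q) (hq1 : q ≤ 1) (hd : Disjoint E₁ E₂) (h₁ : ∀ e ∈ E₁, ∀ z ∈ e, z ∈ V₁)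
    (h₂ : ∀ e ∈ E₂, ∀ z ∈ e, z ∈ V₂) {s t : V} (hS : V₁ ∩ V₂ ⊆ {s, t}) (hst : s ≠ t)
    (hw : ∀ g, ((w g : unitInterval) : ℝ) ≠ 0 → g ∈ E₁ ∪ E₂) {e f : Sym2 V} (he : e ∉ E₂) (hf : f ∉ E₁)
    (mono₁ : netMass w q E₁ (openConn s t ∩ {η | e ∈ η}ᶜ) * netMass w q E₁ ((openConn s t)ᶜ ∩ {η | e ∈ η}) ≤
      netMass w q E₁ (openConn s t ∩ {η | e ∈ η}) * netMass w q E₁ ((openConn s t)ᶜ ∩ {η | e ∈ η}ᶜ))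
    (mono₂ : netMass w q E₂ (openConn s t ∩ {η | f ∈ η}ᶜ) * netMass w q E₂ ((openConn s t)ᶜ ∩ {η | f ∈ η}) ≤
      netMass w q E₂ (openConn s t ∩ {η | f ∈ η}) * netMass w q E₂ ((openConn s t)ᶜ ∩ {η | f ∈ η}ᶜ)) :
    (rcMeasureW w q ∅).real ({ω | e ∈ ω} ∩ {ω | f ∈ ω}) ≤
      (rcMeasureW w q ∅).real {ω | e ∈ ω} * (rcMeasureW w q ∅).real {ω | f ∈ ω} := by
  have hnet := negCorr_net_twoSum_mixed w hq0 hq1 hd h₁ h₂ hS hst he hf mono₁ mono₂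
  have hS' : ∀ A : Set (BondConfig V), netMass w q (E₁ ∪ E₂) A = ∑ ω : BondConfig V, rcWeightW w q ∅ ω * ind A ω :=
    fun A => (sum_rcWeightW_ind_eq_netMass w q hw A).symm
  have hZ' : netMass w q (E₁ ∪ E₂) Set.univ = rcPartitionFunctionW w q ∅ := by
    rw [hS']
    unfold rcPartitionFunctionW
    exact Finset.sum_congr rfl fun ω _ => by rw [ind_of_mem (Set.mem_univ _), mul_one]
  rw [hZ', hS', hS', hS'] at hnet
  have hZ := rcPartitionFunctionW_pos w hq0 (∅ : Set V)
  rw [rcMeasureW_real_eq_sum_div w hq0 ∅, rcMeasureW_real_eq_sum_div w hq0 ∅, rcMeasureW_real_eq_sum_div w hq0 ∅,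
    div_mul_div_comm, div_le_div_iff₀ hZ (mul_pos hZ hZ)]
  calc (∑ ω : BondConfig V, rcWeightW w q ∅ ω * ind ({ω | e ∈ ω} ∩ {ω | f ∈ ω}) ω) *
        (rcPartitionFunctionW w q ∅ * rcPartitionFunctionW w q ∅)
      = ((∑ ω : BondConfig V, rcWeightW w q ∅ ω * ind ({ω | e ∈ ω} ∩ {ω | f ∈ ω}) ω) * rcPartitionFunctionW w q ∅) *
          rcPartitionFunctionW w q ∅ := by ring
    _ ≤ ((∑ ω : BondConfig V, rcWeightW w q ∅ ω * ind {ω | e ∈ ω} ω) *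
          (∑ ω : BondConfig V, rcWeightW w q ∅ ω * ind {ω | f ∈ ω} ω)) * rcPartitionFunctionW w q ∅ :=
        mul_le_mul_of_nonneg_right hnet hZ.le

end Mixed

end FK

end Summit.CriticalPhenomena.PercolationContinuityZ3.Theorems

end
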